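import Mathlib
import Summits.MatrixMultiplication.MatrixMultiplication.Theorems.SnSubsetDichotomyHyperoctahedralThresholdCleanPairDefs
import Summits.MatrixMultiplication.MatrixMultiplication.Theorems.SnSubsetDichotomyHyperoctahedralThresholdRootTypicalSum

/-!
# Clean-pair atom §2: separatedness is typical (`SnSubsetDichotomy.HyperoctahedralThreshold`, stmt-10883)

Helper for crux `SnSubsetDichotomy.HyperoctahedralThreshold` (stmt-MatrixMultiplication-10883), line
`stub_plan_poorRigidCore`, clean-pair atom, depth recursion §2 "typicality of separatedness" (proof plan
`work/ATOM_PROOF.md` of the stub-plan seat).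

Three involutions `μ c` of `Fin n` act on the right on colour words, `y · w := TwinSupplyCS.act μ y w`; `RW a` is the
finset of reduced words of length `a`.  A strand `β ∈ RW a` from the root `p` (`p false = v`, `p true = x`) is
`r`-SEPARATED (`CleanPair.Separated`) when no two slots `(σ, t)`, `(σ', t')` on different sides, or on the same side more
than `r` apart in time, are joined by a colour word of length `≤ r`.  Under the fixed-point hypothesis `|Fix w| ≤ Φ₀` for
every nonempty reduced `w` of length `≤ a + r` we count the triples `(v, x, β)` with `β` NOT separated from `(v, x)`:

* `SepSum.exists_reduced` — every colour word acts like a REDUCED word that is no longer (cancel `c c`: letters are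
  involutions);
* `SepSum.closed_reduced_of_ne'` — the uniform form of `CleanPair.closed_reduced_of_ne`: two distinct reduced words
  `P ≠ P'` leave ONE nonempty reduced word `z`, `|z| ≤ |P| + |P'|`, closed at `y · P` for EVERY `y` with `y · P = y · P'`
  (the construction — strip the common prefix, read one leg backwards — never inspects `y`);
* `SepSum.card_pair_le` — hence `#{y : y · P = y · P'} ≤ Φ₀` (`y ↦ y · P` is injective into `Fix z`), and
  `SepSum.card_sameSide_le` — for `β ∈ RW a`, a reduced `w` with `|w| ≤ r` and times `s + r < t ≤ a`:
  `#{y : (y · β_[s]) · w = y · β_[t]} ≤ Φ₀` (`β_[t] = β_[s] ++ q` with `q` reduced of length `t - s > r ≥ |w|`, so `q ≠ w`);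
* `SepSum.witness` — a non-separated strand has a REDUCED connecting word `w`, `|w| ≤ r`, in one of three normal shapes
  (read `w` backwards to orient it): CROSS `(v · β_[t]) · w = x · β_[t']`, or SAME-SIDE FORWARD `(y · β_[t]) · w = y · β_[t']`
  with `t + r < t'` and `y = v` or `y = x`;
* `SepSum.sum_sum_card_le` — the census: index the three shapes by `(t, t', w)` (`(a+1)² · |W_{≤ r}|` indices, where
  `|W_{≤ r}| ≤ ∑_{j ≤ r} 3 · 2^j < 3 · 2^(r+1)`); summed over all roots their `β`-fibres have `≤ n` (cross: `x` is `v`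
  carried by a fixed word), `≤ Φ₀ · n` and `≤ n · Φ₀` members, and `|RW a| ≤ 3 · 2^a`, so the non-separated triples
  number at most `(a+1)² · 3·2^(r+1) · 3·2^a · 2n(Φ₀+1) = 2 (a+1)² (3·2^(r+1)) (Φ₀+1) n (3·2^a)`;
* `stub_separatedSum` — the registered form.

Pure finite counting in the vocabulary of `…CleanPairDefs`; no definitions (`RootTypicalSum.foldl_injective`,
`RootTypicalSum.card_RW_le` are reused).  The census is organised like `RootSelfCleanSum.sum_sum_card_le` of the sibling
file `…RootSelfCleanSum`.
-/

-- the tree's namespace `Summit.MatrixMultiplication.MatrixMultiplication.…` repeats a component by design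
set_option linter.dupNamespace false

namespace Summit.MatrixMultiplication.MatrixMultiplication.Theorems.HyperoctahedralThreshold

namespace CleanPair.SepSum

open Finset TwinSupplyCS

variable {n : ℕ}

/-- Every colour word acts like a REDUCED word that is no longer (cancel adjacent equal letters, `μ c (μ c y) = y`). -/
theorem exists_reduced (μ : Fin 3 → Equiv.Perm (Fin n)) (hμ : ∀ c, μ c * μ c = 1) :
    ∀ w : List (Fin 3), ∃ w' : List (Fin 3), List.IsChain (· ≠ ·) w' ∧ w'.length ≤ w.length ∧
      ∀ y : Fin n, act μ y w' = act μ y w := by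
  intro w
  induction w with
  | nil => exact ⟨[], List.IsChain.nil, le_rfl, fun _ => rfl⟩
  | cons c w ih =>
    obtain ⟨w', hc', hl', he'⟩ := ih
    cases w' with
    | nil => exact ⟨[c], List.IsChain.singleton c, by simp, fun y => he' (μ c y)⟩
    | cons d rest =>
      by_cases hcd : c = d
      · subst hcd
        refine ⟨rest, hc'.tail, by simp only [List.length_cons] at hl' ⊢; omega, fun y => ?_⟩
        have e : act μ (μ c (μ c y)) rest = act μ y (c :: w) := he' (μ c y)
        rwa [involutive_of_mul_self μ hμ c y] at e
      · exact ⟨c :: d :: rest, List.IsChain.cons_cons hcd hc', by simp only [List.length_cons] at hl' ⊢; omega,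
          fun y => he' (μ c y)⟩

-- adapted from Summits/.../SnSubsetDichotomyHyperoctahedralThresholdCleanPairDefs.lean (`CleanPair.closed_reduced_of_ne`)
/-- **Distinct legs close a reduced walk, uniformly in the base point.**  Two DISTINCT reduced words `P ≠ P'` leave one
nonempty REDUCED word `z` of length `≤ |P| + |P'|` that is closed at `y · P` for every `y` with `y · P = y · P'`
(strip the longest common prefix, read one leg backwards; the word does not depend on `y`). -/
theorem closed_reduced_of_ne' (μ : Fin 3 → Equiv.Perm (Fin n)) (hμ : ∀ c, μ c * μ c = 1) :
    ∀ P P' : List (Fin 3), P ≠ P' → List.IsChain (· ≠ ·) P → List.IsChain (· ≠ ·) P' →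
      ∃ z : List (Fin 3), z ≠ [] ∧ List.IsChain (· ≠ ·) z ∧ z.length ≤ P.length + P'.length ∧
        ∀ y : Fin n, act μ y P = act μ y P' → act μ (act μ y P) z = act μ y P := by
  intro P
  induction P with
  | nil =>
    intro P' hne _ hc'
    refine ⟨P', fun h => hne h.symm, hc', by simp, fun y he => ?_⟩
    simp only [act, List.foldl_nil] at he ⊢
    exact he.symm
  | cons c P ih =>
    intro P' hne hc hc'
    cases P' with
    | nil =>
      refine ⟨(c :: P).reverse, by simp, List.isChain_reverse.mpr (hc.imp fun a b h => Ne.symm h), by simp,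
        fun y he => ?_⟩
      rw [act_act_reverse μ (involutive_of_mul_self μ hμ)]
      simp only [act, List.foldl_nil] at he
      exact he.symm
    | cons c' P' =>
      by_cases hcc : c = c'
      · subst hcc
        have hne' : P ≠ P' := fun h => hne (by rw [h])
        obtain ⟨z, h1, h2, h3, h4⟩ := ih P' hne' hc.tail hc'.tail
        refine ⟨z, h1, h2, by simp; omega, fun y he => ?_⟩
        have he' : act μ (μ c y) P = act μ (μ c y) P' := by simpa [act] using he
        simpa [act] using h4 (μ c y) he'
      · refine ⟨(c :: P).reverse ++ (c' :: P'), by simp, ?_, by simp; omega, fun y he => ?_⟩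
        · rw [List.isChain_append]
          refine ⟨List.isChain_reverse.mpr (hc.imp fun a b h => Ne.symm h), hc', ?_⟩
          intro a ha b hb
          rw [List.getLast?_reverse, List.head?_cons, Option.mem_def, Option.some.injEq] at ha
          rw [List.head?_cons, Option.mem_def, Option.some.injEq] at hb
          rw [← ha, ← hb]; exact hcc
        · rw [act_append, act_act_reverse μ (involutive_of_mul_self μ hμ)]
          exact he.symm

/-- **Two-word coincidence fibre.**  If every nonempty reduced word of length `≤ a + r` fixes at most `Φ₀` points, then
for distinct reduced `P ≠ P'` with `|P| + |P'| ≤ a + r` the points `y` with `y · P = y · P'` number at most `Φ₀`: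
`y ↦ y · P` carries them injectively into `Fix z` for the word `z` of `closed_reduced_of_ne'`. -/
theorem card_pair_le (μ : Fin 3 → Equiv.Perm (Fin n)) (hμ : ∀ c, μ c * μ c = 1) {a r Φ₀ : ℕ}
    (hΦ : ∀ w : List (Fin 3), w ≠ [] → List.IsChain (· ≠ ·) w → w.length ≤ a + r →
      ((Finset.univ : Finset (Fin n)).filter (fun y => w.foldl (fun v b => μ b v) y = y)).card ≤ Φ₀)
    (P P' : List (Fin 3)) (hne : P ≠ P') (hc : List.IsChain (· ≠ ·) P) (hc' : List.IsChain (· ≠ ·) P')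
    (hl : P.length + P'.length ≤ a + r) :
    ((univ : Finset (Fin n)).filter (fun y => act μ y P = act μ y P')).card ≤ Φ₀ := by
  obtain ⟨z, h1, h2, h3, h4⟩ := closed_reduced_of_ne' μ hμ P P' hne hc hc'
  refine le_trans ?_ (hΦ z h1 h2 (h3.trans hl))
  refine card_le_card_of_injOn (fun y => act μ y P) ?_ ?_
  · intro y hy
    rw [mem_coe, mem_filter] at hy ⊢
    exact ⟨mem_univ _, h4 y hy.2⟩
  · exact fun y _ y' _ h => RootTypicalSum.foldl_injective μ P h

/-- **Same-side fibre.**  Under the same fixed-point hypothesis, for a reduced `g` of length `a`, a reduced `w` with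
`|w| ≤ r` and times `s + r < t ≤ a`, the points `y` with `(y · g_[s]) · w = y · g_[t]` number at most `Φ₀`:
`g_[t] = g_[s] ++ q` with `q` reduced of length `t - s > r ≥ |w|`, so `q ≠ w`, and `y ↦ y · g_[s]` is injective into the
two-word fibre of `(w, q)`. -/
theorem card_sameSide_le (μ : Fin 3 → Equiv.Perm (Fin n)) (hμ : ∀ c, μ c * μ c = 1) {a r Φ₀ : ℕ}
    (hΦ : ∀ w : List (Fin 3), w ≠ [] → List.IsChain (· ≠ ·) w → w.length ≤ a + r →
      ((Finset.univ : Finset (Fin n)).filter (fun y => w.foldl (fun v b => μ b v) y = y)).card ≤ Φ₀)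
    {g : List (Fin 3)} (hg : g ∈ RW a) {w : List (Fin 3)} (hwc : List.IsChain (· ≠ ·) w) (hwl : w.length ≤ r)
    {s t : ℕ} (hst : s + r < t) (hta : t ≤ a) :
    ((univ : Finset (Fin n)).filter (fun y => act μ (act μ y (g.take s)) w = act μ y (g.take t))).card ≤ Φ₀ := by
  rw [mem_RW] at hg
  set q := (g.take t).drop s with hq
  have hsplit : g.take t = g.take s ++ q := by
    have h := (List.take_append_drop s (g.take t)).symm
    rw [List.take_take, Nat.min_eq_left (by omega : s ≤ t)] at h
    exact h
  have hqlen : q.length = t - s := by rw [hq, List.length_drop, List.length_take]; omega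
  have hqc : List.IsChain (· ≠ ·) q := (hg.2.take t).drop s
  have hne : w ≠ q := fun h => by rw [h] at hwl; omega
  refine le_trans ?_ (card_pair_le μ hμ hΦ w q hne hwc hqc (by omega))
  refine card_le_card_of_injOn (fun y => act μ y (g.take s)) ?_ ?_
  · intro y hy
    rw [mem_coe, mem_filter] at hy ⊢
    refine ⟨mem_univ _, ?_⟩
    rw [hy.2, hsplit, act_append]
  · exact fun y _ y' _ h => RootTypicalSum.foldl_injective μ (g.take s) h

/-- **Normal form of a separatedness failure.**  A strand that is not `r`-separated from `p` has a REDUCED connecting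
word `w` with `|w| ≤ r` between two slots, in one of three shapes: cross `(p false · β_[t]) · w = p true · β_[t']`, or
same-side forward in time, `(p σ · β_[t]) · w = p σ · β_[t']` with `t + r < t'`, on the side `σ = false` or `σ = true`
(reduce the word by `exists_reduced`; read it backwards to fix the orientation). -/
theorem witness (μ : Fin 3 → Equiv.Perm (Fin n)) (hμ : ∀ c, μ c * μ c = 1) {r : ℕ} {p : Bool → Fin n}
    {β : List (Fin 3)} (h : ¬ Separated μ r p β) :
    ∃ t t' : ℕ, ∃ w : List (Fin 3), t ≤ β.length ∧ t' ≤ β.length ∧ List.IsChain (· ≠ ·) w ∧ w.length ≤ r ∧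
      (act μ (act μ (p false) (β.take t)) w = act μ (p true) (β.take t') ∨
        (t + r < t' ∧ (act μ (act μ (p false) (β.take t)) w = act μ (p false) (β.take t') ∨
          act μ (act μ (p true) (β.take t)) w = act μ (p true) (β.take t')))) := by
  unfold Separated at h
  push Not at h
  obtain ⟨σ, σ', t, t', ht, ht', hcond, w₀, hw₀, he₀⟩ := h
  obtain ⟨w, hwc, hwl, hwe⟩ := exists_reduced μ hμ w₀
  have he : act μ (pos μ p β σ t) w = pos μ p β σ' t' := by rw [hwe]; exact he₀
  have he' : act μ (pos μ p β σ' t') w.reverse = pos μ p β σ t := by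
    rw [← he, act_act_reverse μ (involutive_of_mul_self μ hμ)]
  have hwc' : List.IsChain (· ≠ ·) w.reverse := List.isChain_reverse.mpr (hwc.imp fun a b h => Ne.symm h)
  have hwl' : w.reverse.length ≤ r := by rw [List.length_reverse]; omega
  simp only [pos] at he he'
  by_cases hσ : σ = σ'
  · subst hσ
    rcases hcond with h0 | hlt | hgt
    · exact absurd rfl h0
    · refine ⟨t, t', w, ht, ht', hwc, by omega, Or.inr ⟨hlt, ?_⟩⟩
      cases σ
      · exact Or.inl he
      · exact Or.inr he
    · refine ⟨t', t, w.reverse, ht', ht, hwc', hwl', Or.inr ⟨hgt, ?_⟩⟩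
      cases σ
      · exact Or.inl he'
      · exact Or.inr he'
  · cases σ <;> cases σ'
    · exact absurd rfl hσ
    · exact ⟨t, t', w, ht, ht', hwc, by omega, Or.inl he⟩
    · exact ⟨t', t, w.reverse, ht', ht, hwc', hwl', Or.inl he'⟩
    · exact absurd rfl hσ

/-- The reduced words of length `≤ r` number at most `∑_{j ≤ r} 3 · 2^j < 3 · 2^(r+1)`. -/
theorem card_biUnion_RW_le (r : ℕ) : ((range (r + 1)).biUnion RW).card ≤ 3 * 2 ^ (r + 1) := by
  refine card_biUnion_le.trans ?_
  calc ∑ j ∈ range (r + 1), (RW j).card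
      ≤ ∑ j ∈ range (r + 1), 3 * 2 ^ j := sum_le_sum fun j _ => RootTypicalSum.card_RW_le j
    _ = 3 * ∑ j ∈ range (r + 1), 2 ^ j := by rw [mul_sum]
    _ ≤ 3 * 2 ^ (r + 1) :=
        Nat.mul_le_mul_left 3 (Nat.geomSum_lt (le_refl 2) (fun k hk => mem_range.1 hk)).le

-- adapted from Summits/.../SnSubsetDichotomyHyperoctahedralThresholdRootSelfCleanSum.lean (`RootSelfCleanSum.sum_sum_card_le`)
/-- **Separatedness census.**  Let every nonempty reduced word of length `≤ a + r` fix at most `Φ₀` points, and let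
`S v x ⊆ RW a` (for every root `(v, x)`) consist of words `β` admitting times `t, t' ≤ a` and a reduced `w` with `|w| ≤ r`
in one of the three shapes of `witness`: `(v · β_[t]) · w = x · β_[t']`, or `t + r < t'` and `(y · β_[t]) · w = y · β_[t']`
for `y = v` or `y = x`.  Then `∑_v ∑_x |S v x| ≤ 2 (a+1)² (3 · 2^(r+1)) (Φ₀+1) n (3 · 2^a)`: the three families, indexed
by `(t, t', w)`, have word-fibres of size `≤ n`, `≤ Φ₀ · n`, `≤ n · Φ₀`; there are `≤ 3 · 2^a` words and
`≤ (a+1)² · 3 · 2^(r+1)` indices. -/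
theorem sum_sum_card_le (μ : Fin 3 → Equiv.Perm (Fin n)) (hμ : ∀ c, μ c * μ c = 1) {a r Φ₀ : ℕ}
    (hΦ : ∀ w : List (Fin 3), w ≠ [] → List.IsChain (· ≠ ·) w → w.length ≤ a + r →
      ((Finset.univ : Finset (Fin n)).filter (fun y => w.foldl (fun v b => μ b v) y = y)).card ≤ Φ₀)
    (S : Fin n → Fin n → Finset (List (Fin 3)))
    (hS : ∀ v x, ∀ β ∈ S v x, β ∈ RW a ∧ ∃ t ≤ a, ∃ t' ≤ a, ∃ w : List (Fin 3), List.IsChain (· ≠ ·) w ∧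
      w.length ≤ r ∧ (act μ (act μ v (β.take t)) w = act μ x (β.take t') ∨
        (t + r < t' ∧ (act μ (act μ v (β.take t)) w = act μ v (β.take t') ∨
          act μ (act μ x (β.take t)) w = act μ x (β.take t'))))) :
    ∑ v : Fin n, ∑ x : Fin n, (S v x).card ≤ 2 * (a + 1) ^ 2 * (3 * 2 ^ (r + 1)) * (Φ₀ + 1) * n * (3 * 2 ^ a) := by
  classical
  set W := RW a with hWdef
  set Wr := (range (r + 1)).biUnion RW with hWr
  have memWr : ∀ w ∈ Wr, List.IsChain (· ≠ ·) w ∧ w.length ≤ r := by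
    intro w hw
    rw [hWr, mem_biUnion] at hw
    obtain ⟨j, hj, hw⟩ := hw
    rw [mem_range] at hj
    rw [mem_RW] at hw
    exact ⟨hw.2, by omega⟩
  have mem_Wr : ∀ w : List (Fin 3), List.IsChain (· ≠ ·) w → w.length ≤ r → w ∈ Wr := fun w hc hl =>
    mem_biUnion.2 ⟨w.length, mem_range.2 (Nat.lt_succ_of_le hl), mem_RW.2 ⟨rfl, hc⟩⟩
  set D := ((univ : Finset (Fin n)) ×ˢ (univ : Finset (Fin n))) ×ˢ W with hD
  -- the three families, indexed by `i = ((t, t'), w)`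
  set Cvx : (ℕ × ℕ) × List (Fin 3) → Finset ((Fin n × Fin n) × List (Fin 3)) := fun i => D.filter
    (fun p : (Fin n × Fin n) × List (Fin 3) =>
      act μ (act μ p.1.1 (p.2.take i.1.1)) i.2 = act μ p.1.2 (p.2.take i.1.2)) with hCvx
  set Cvv : (ℕ × ℕ) × List (Fin 3) → Finset ((Fin n × Fin n) × List (Fin 3)) := fun i => D.filter
    (fun p : (Fin n × Fin n) × List (Fin 3) => i.1.1 + r < i.1.2 ∧
      act μ (act μ p.1.1 (p.2.take i.1.1)) i.2 = act μ p.1.1 (p.2.take i.1.2)) with hCvv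
  set Cxx : (ℕ × ℕ) × List (Fin 3) → Finset ((Fin n × Fin n) × List (Fin 3)) := fun i => D.filter
    (fun p : (Fin n × Fin n) × List (Fin 3) => i.1.1 + r < i.1.2 ∧
      act μ (act μ p.1.2 (p.2.take i.1.1)) i.2 = act μ p.1.2 (p.2.take i.1.2)) with hCxx
  -- fibrewise bound: a family cut out of `D` by a condition whose word-fibres have `≤ M` roots has `≤ |W| · M` members
  have fib : ∀ (P : (Fin n × Fin n) × List (Fin 3) → Prop) [DecidablePred P] (M : ℕ),
      (∀ g ∈ W, (((univ : Finset (Fin n)) ×ˢ (univ : Finset (Fin n))).filter (fun vx => P (vx, g))).card ≤ M) →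
      (D.filter P).card ≤ W.card * M := by
    intro P _ M hP
    have hmaps : Set.MapsTo (Prod.snd : (Fin n × Fin n) × List (Fin 3) → List (Fin 3)) ↑(D.filter P) ↑W := by
      intro p hp
      rw [Finset.mem_coe, Finset.mem_filter, hD, Finset.mem_product] at hp
      exact Finset.mem_coe.2 hp.1.2
    rw [Finset.card_eq_sum_card_fiberwise hmaps]
    calc ∑ g ∈ W, ((D.filter P).filter (fun p => p.2 = g)).card
        ≤ ∑ _g ∈ W, M := by
          refine Finset.sum_le_sum (fun g hg => ?_)
          refine le_trans ?_ (hP g hg)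
          refine Finset.card_le_card_of_injOn Prod.fst ?_ ?_
          · intro p hp
            rw [Finset.mem_coe, Finset.mem_filter, Finset.mem_filter] at hp
            rw [Finset.mem_coe, Finset.mem_filter]
            refine ⟨Finset.mem_product.2 ⟨Finset.mem_univ _, Finset.mem_univ _⟩, ?_⟩
            rw [← hp.2]
            exact hp.1.2
          · intro p hp q hq hpq
            rw [Finset.mem_coe, Finset.mem_filter] at hp hq
            exact Prod.ext hpq (hp.2.trans hq.2.symm)
      _ = W.card * M := by rw [Finset.sum_const, smul_eq_mul]
  set I := (range (a + 1) ×ˢ range (a + 1)) ×ˢ Wr with hI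
  have memI : ∀ i ∈ I, (i.1.1 ≤ a ∧ i.1.2 ≤ a) ∧ List.IsChain (· ≠ ·) i.2 ∧ i.2.length ≤ r := by
    intro i hi
    rw [hI, mem_product, mem_product, mem_range, mem_range] at hi
    exact ⟨⟨by omega, by omega⟩, memWr i.2 hi.2⟩
  -- the three families are small
  have hCvx_le : ∀ i ∈ I, (Cvx i).card ≤ W.card * n := by
    intro i _
    refine fib _ _ (fun g _ => ?_)
    have h := Finset.card_le_card_of_injOn (s := ((univ : Finset (Fin n)) ×ˢ (univ : Finset (Fin n))).filter
        (fun vx : Fin n × Fin n => act μ (act μ vx.1 (g.take i.1.1)) i.2 = act μ vx.2 (g.take i.1.2)))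
      (t := (univ : Finset (Fin n))) Prod.fst (fun vx _ => Finset.mem_coe.2 (Finset.mem_univ _)) ?_
    · rwa [Finset.card_univ, Fintype.card_fin] at h
    · intro vx hvx vx' hvx' h1
      simp only [Finset.mem_coe, Finset.mem_filter, Finset.mem_product, Finset.mem_univ, true_and] at hvx hvx'
      refine Prod.ext h1 (RootTypicalSum.foldl_injective μ (g.take i.1.2) ?_)
      change act μ vx.2 (g.take i.1.2) = act μ vx'.2 (g.take i.1.2)
      rw [← hvx, ← hvx', h1]
  have hCvv_le : ∀ i ∈ I, (Cvv i).card ≤ W.card * (Φ₀ * n) := by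
    intro i hi
    obtain ⟨hta, hwc, hwl⟩ := memI i hi
    refine fib _ _ (fun g hg => ?_)
    by_cases hlt : i.1.1 + r < i.1.2
    · calc (((univ : Finset (Fin n)) ×ˢ (univ : Finset (Fin n))).filter (fun vx : Fin n × Fin n =>
            i.1.1 + r < i.1.2 ∧ act μ (act μ vx.1 (g.take i.1.1)) i.2 = act μ vx.1 (g.take i.1.2))).card
          ≤ (((univ : Finset (Fin n)).filter (fun y => act μ (act μ y (g.take i.1.1)) i.2 = act μ y (g.take i.1.2)))
              ×ˢ (univ : Finset (Fin n))).card := by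
            refine Finset.card_le_card (fun vx h => ?_)
            rw [Finset.mem_filter] at h
            exact Finset.mem_product.2 ⟨Finset.mem_filter.2 ⟨Finset.mem_univ _, h.2.2⟩, Finset.mem_univ _⟩
        _ ≤ Φ₀ * n := by
            rw [Finset.card_product, Finset.card_univ, Fintype.card_fin]
            exact Nat.mul_le_mul_right _ (card_sameSide_le μ hμ hΦ hg hwc hwl hlt hta.2)
    · rw [Finset.filter_false_of_mem (fun vx _ h => hlt h.1), Finset.card_empty]
      exact Nat.zero_le _
  have hCxx_le : ∀ i ∈ I, (Cxx i).card ≤ W.card * (n * Φ₀) := by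
    intro i hi
    obtain ⟨hta, hwc, hwl⟩ := memI i hi
    refine fib _ _ (fun g hg => ?_)
    by_cases hlt : i.1.1 + r < i.1.2
    · calc (((univ : Finset (Fin n)) ×ˢ (univ : Finset (Fin n))).filter (fun vx : Fin n × Fin n =>
            i.1.1 + r < i.1.2 ∧ act μ (act μ vx.2 (g.take i.1.1)) i.2 = act μ vx.2 (g.take i.1.2))).card
          ≤ ((univ : Finset (Fin n)) ×ˢ ((univ : Finset (Fin n)).filter (fun y =>
              act μ (act μ y (g.take i.1.1)) i.2 = act μ y (g.take i.1.2)))).card := by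
            refine Finset.card_le_card (fun vx h => ?_)
            rw [Finset.mem_filter] at h
            exact Finset.mem_product.2 ⟨Finset.mem_univ _, Finset.mem_filter.2 ⟨Finset.mem_univ _, h.2.2⟩⟩
        _ ≤ n * Φ₀ := by
            rw [Finset.card_product, Finset.card_univ, Fintype.card_fin]
            exact Nat.mul_le_mul_left _ (card_sameSide_le μ hμ hΦ hg hwc hwl hlt hta.2)
    · rw [Finset.filter_false_of_mem (fun vx _ h => hlt h.1), Finset.card_empty]
      exact Nat.zero_le _
  -- the double sum counts the triples `((v, x), β)` with `β ∈ S v x`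
  have hsum : ∑ v : Fin n, ∑ x : Fin n, (S v x).card =
      (((univ : Finset (Fin n)) ×ˢ (univ : Finset (Fin n))).sigma (fun vx : Fin n × Fin n => S vx.1 vx.2)).card := by
    rw [Finset.card_sigma, Finset.sum_product]
  rw [hsum]
  -- cover: such a triple lies in one of the three families at some index `((t, t'), w) ∈ I`
  have hcover : Set.MapsTo
      (fun p : (Σ _ : Fin n × Fin n, List (Fin 3)) => ((p.1, p.2) : (Fin n × Fin n) × List (Fin 3)))
      ↑(((univ : Finset (Fin n)) ×ˢ (univ : Finset (Fin n))).sigma (fun vx : Fin n × Fin n => S vx.1 vx.2))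
      ↑(I.biUnion (fun i => Cvx i ∪ Cvv i ∪ Cxx i)) := by
    intro p hp
    rw [Finset.mem_coe, Finset.mem_sigma] at hp
    obtain ⟨hβ, t, ht, t', ht', w, hwc, hwl, h⟩ := hS p.1.1 p.1.2 p.2 hp.2
    have hpD : ((p.1, p.2) : (Fin n × Fin n) × List (Fin 3)) ∈ D :=
      Finset.mem_product.2 ⟨Finset.mem_product.2 ⟨Finset.mem_univ _, Finset.mem_univ _⟩, hβ⟩
    have hi : ((t, t'), w) ∈ I :=
      Finset.mem_product.2 ⟨Finset.mem_product.2 ⟨Finset.mem_range.2 (Nat.lt_succ_of_le ht),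
        Finset.mem_range.2 (Nat.lt_succ_of_le ht')⟩, mem_Wr w hwc hwl⟩
    rw [Finset.mem_coe, Finset.mem_biUnion]
    rcases h with e | ⟨hlt, e | e⟩
    · exact ⟨((t, t'), w), hi, Finset.mem_union_left _ (Finset.mem_union_left _ (Finset.mem_filter.2 ⟨hpD, e⟩))⟩
    · exact ⟨((t, t'), w), hi, mem_union_left _ (mem_union_right _ (mem_filter.2 ⟨hpD, hlt, e⟩))⟩
    · exact ⟨((t, t'), w), hi, Finset.mem_union_right _ (Finset.mem_filter.2 ⟨hpD, hlt, e⟩)⟩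
  have hinj : Set.InjOn
      (fun p : (Σ _ : Fin n × Fin n, List (Fin 3)) => ((p.1, p.2) : (Fin n × Fin n) × List (Fin 3)))
      ↑(((univ : Finset (Fin n)) ×ˢ (univ : Finset (Fin n))).sigma (fun vx : Fin n × Fin n => S vx.1 vx.2)) := by
    rintro ⟨vx, β⟩ - ⟨vx', β'⟩ - h
    simp only [Prod.mk.injEq] at h
    obtain ⟨rfl, rfl⟩ := h
    rfl
  refine (Finset.card_le_card_of_injOn _ hcover hinj).trans (Finset.card_biUnion_le.trans ?_)
  have hterm : ∀ i ∈ I, (Cvx i ∪ Cvv i ∪ Cxx i).card ≤ W.card * (2 * n * (Φ₀ + 1)) := by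
    intro i hi
    calc (Cvx i ∪ Cvv i ∪ Cxx i).card ≤ (Cvx i ∪ Cvv i).card + (Cxx i).card := Finset.card_union_le _ _
      _ ≤ (Cvx i).card + (Cvv i).card + (Cxx i).card := Nat.add_le_add_right (Finset.card_union_le _ _) _
      _ ≤ W.card * n + W.card * (Φ₀ * n) + W.card * (n * Φ₀) :=
          Nat.add_le_add (Nat.add_le_add (hCvx_le i hi) (hCvv_le i hi)) (hCxx_le i hi)
      _ ≤ W.card * n + W.card * (Φ₀ * n) + W.card * (n * Φ₀) + W.card * n := Nat.le_add_right _ _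
      _ = W.card * (2 * n * (Φ₀ + 1)) := by ring
  refine (Finset.sum_le_sum hterm).trans ?_
  rw [Finset.sum_const, smul_eq_mul, hI, Finset.card_product, Finset.card_product, Finset.card_range]
  calc (a + 1) * (a + 1) * Wr.card * (W.card * (2 * n * (Φ₀ + 1)))
      ≤ (a + 1) * (a + 1) * (3 * 2 ^ (r + 1)) * ((3 * 2 ^ a) * (2 * n * (Φ₀ + 1))) :=
        Nat.mul_le_mul (Nat.mul_le_mul_left _ (card_biUnion_RW_le r)) (Nat.mul_le_mul_right _ (RootTypicalSum.card_RW_le a))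
    _ = 2 * (a + 1) ^ 2 * (3 * 2 ^ (r + 1)) * (Φ₀ + 1) * n * (3 * 2 ^ a) := by ring

end CleanPair.SepSum

open TwinSupplyCS CleanPair CleanPair.SepSum in
open Classical in
/-- **`stub_separatedSum`** (registered sub-goal of stmt-MatrixMultiplication-10883; clean-pair atom §2, the separatedness
numerator): if every nonempty reduced word of length `≤ a + r` fixes at most `Φ₀` points, then summed over all `n²`
ordered roots `(v, x)` the reduced words `β` of length `a` that are NOT `r`-separated from `(v, x)` number at most
`2 (a+1)² (3 · 2^(r+1)) (Φ₀+1) n (3 · 2^a)` (`SepSum.witness` + `SepSum.sum_sum_card_le`).  Fixed-point-freeness of the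
colours is not used. -/
theorem stub_separatedSum : ∀ (n a r Φ₀ : ℕ) (μ : Fin 3 → Equiv.Perm (Fin n)), (∀ c, μ c * μ c = 1) → (∀ w : List (Fin 3), w ≠ [] → List.IsChain (· ≠ ·) w → w.length ≤ a + r → ((Finset.univ : Finset (Fin n)).filter (fun y => w.foldl (fun v b => μ b v) y = y)).card ≤ Φ₀) → ∑ v : Fin n, ∑ x : Fin n, ((Summit.MatrixMultiplication.MatrixMultiplication.Theorems.HyperoctahedralThreshold.TwinSupplyCS.RW a).filter (fun β => ¬ Summit.MatrixMultiplication.MatrixMultiplication.Theorems.HyperoctahedralThreshold.CleanPair.Separated μ r (fun σ => bif σ then x else v) β)).card ≤ 2 * (a + 1) ^ 2 * (3 * 2 ^ (r + 1)) * (Φ₀ + 1) * n * (3 * 2 ^ a) := by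
  intro n a r Φ₀ μ hμ hΦ
  refine sum_sum_card_le μ hμ hΦ _ (fun v x β hβ => ?_)
  rw [Finset.mem_filter] at hβ
  obtain ⟨hβW, hns⟩ := hβ
  have hl : β.length = a := (mem_RW.1 hβW).1
  obtain ⟨t, t', w, ht, ht', hwc, hwl, h⟩ := witness μ hμ hns
  rw [hl] at ht ht'
  exact ⟨hβW, t, ht, t', ht', w, hwc, hwl, h⟩

end Summit.MatrixMultiplication.MatrixMultiplication.Theorems.HyperoctahedralThreshold
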